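import Mathlib
import HarnessLib
import Summits.FinalStateConjecture.Statement
import Literature.Geometry.Lorentzian.LandauLifshitzPseudotensor
import Summits.FinalStateConjecture.FinalStateConjecture.Theorems.EIHFluxBalanceInertialRecessionStubQuasiStationarityLorentzAlgebra
import Summits.FinalStateConjecture.FinalStateConjecture.Theorems.EIHFluxBalanceInertialRecessionLorentz
import Summits.FinalStateConjecture.FinalStateConjecture.Theorems.InertialRecession.Negative.PaintingRigidityStabiliser

/-!
# Route EIHFluxBalance — `InertialRecession`, re-charting: untwisting the painted frame of a
# rotating hole — the untwisting angle and the transport laws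

Helper file for the crux `stmt-FinalStateConjecture-10166`
(`Summit.FinalStateConjecture.FinalStateConjecture.Theses.EIHFluxBalance.InertialRecession`),
line `sublinear-is-free-clean-window-charges`, stub `stub_rechart` (the transfer P2).

The crux hypothesis paints hole `i` with an arbitrary smooth Lorentz path `Λᵢ(t)`; slaving only
controls what the Kerr–Schild form sees — the 4-velocity `uᵢ = Λᵢe₀` and, for `aᵢ ≠ 0`, the spin
axis `sᵢ = Λᵢe₃` — while `Λᵢ(t)` itself may spin arbitrarily fast in the stabiliser (rotations
about the axis, `Negative/PaintingRigidityStabiliser`). The hole charts and the flat-chart estimate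
need frame paths whose lab-time derivatives tend to `0`. This file UNTWISTS the painted frame:

  `Λ̃(t) = Λ(t) · R_{θ(t)}`,  `θ(t) = ∫₀ᵗ η(Λ(s)e₁, Λ′(s)e₂) ds`,

the unique right translate by spin-axis rotations whose columns `p = Λ̃e₁`, `q = Λ̃e₂` obey the
transport law `p′ = η(p, u′)u − η(p, s′)s` (no rotation in the `p–q` plane). It paints the same
reference field (`boostedKerrBilin_mul_rotL`) and the same radius, has the same `e₀` and `e₃`
columns, and — by the transport decay lemma `tendsto_iteratedDeriv_of_transport` of file
`…StubRechartLeibniz` — its derivatives of orders `1 … k` tend to `0` as soon as those of `u` and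
`s` do. THIS FILE constructs `θ` and proves the transport laws (`exists_untwisting_angle'`,
registered one-line form unprimed); the decay statement is assembled in `…StubRechartUntwist`.

[folklore: Fermi–Walker-type transport in `O(1,3)`; O'Neill 1983, Ch. 9]
-/

noncomputable section

set_option linter.dupNamespace false

open Set Filter Function Topology MeasureTheory Literature.Geometry.Lorentzian
open Summit.FinalStateConjecture.FinalStateConjecture.Theorems
open Summit.FinalStateConjecture.FinalStateConjecture.Theorems.InertialRecession.Negative
open scoped ContDiff BigOperators

namespace Summit.FinalStateConjecture.FinalStateConjecture.Theorems.SublinearIsFree.Rechart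

/-! ### Minkowski products with the coordinate basis; the moving-frame expansion -/

/-- Componentwise extensionality on `E4` (private: the same statement exists in an unrelated
symplectic file, `euclidean_four_ext`, which would be the wrong dependency). [folklore] -/
private theorem E4_ext {v w : E4} (h0 : v 0 = w 0) (h1 : v 1 = w 1) (h2 : v 2 = w 2) (h3 : v 3 = w 3) :
    v = w := by
  ext k
  fin_cases k <;> assumption

/-- `η(v, e₀) = −v⁰`. [folklore] -/
theorem minkowski_basisVector_zero_right (v : E4) :
    Minkowski.bilin v (E4.basisVector 0) = -v 0 := by
  rw [Minkowski.bilin_symm, Minkowski.bilin_basisVector_zero_left]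

/-- `η(v, e₁) = v¹`. [folklore] -/
theorem minkowski_basisVector_one_right (v : E4) : Minkowski.bilin v (E4.basisVector 1) = v 1 := by
  simp [Fin.sum_univ_three, Fin.succ_zero_eq_one, Fin.succ_one_eq_two,
    show (2 : Fin 3).succ = (3 : Fin 4) from rfl]

/-- `η(v, e₂) = v²`. [folklore] -/
theorem minkowski_basisVector_two_right (v : E4) : Minkowski.bilin v (E4.basisVector 2) = v 2 := by
  simp [Fin.sum_univ_three, Fin.succ_zero_eq_one, Fin.succ_one_eq_two,
    show (2 : Fin 3).succ = (3 : Fin 4) from rfl]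

/-- `η(v, e₃) = v³`. [folklore] -/
theorem minkowski_basisVector_three_right (v : E4) :
    Minkowski.bilin v (E4.basisVector 3) = v 3 := by
  simp [Fin.sum_univ_three, Fin.succ_zero_eq_one, Fin.succ_one_eq_two,
    show (2 : Fin 3).succ = (3 : Fin 4) from rfl]

/-- Expansion of a vector of `E4` in the coordinate basis. [folklore] -/
@[deprecated Summit.FinalStateConjecture.FinalStateConjecture.Theorems.SublinearIsFree.QuasiStationarity.eq_sum_basisVector (since := "2026-08-17")]
alias eq_sum_smul_basisVector := Summit.FinalStateConjecture.FinalStateConjecture.Theorems.SublinearIsFree.QuasiStationarity.eq_sum_basisVector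

/-- **The moving-frame expansion**: for `Λ ∈ O(1,3)` with columns `u, a, b, s = Λe₀, …, Λe₃`,
every `X ∈ E4` is `X = −η(X,u) u + η(X,a) a + η(X,b) b + η(X,s) s`. [folklore] -/
theorem frame_expansion (Λ : lorentzGroup) (X : E4) :
    X = (-Minkowski.bilin X ((Λ : E4 ≃L[ℝ] E4) (E4.basisVector 0))) •
          (Λ : E4 ≃L[ℝ] E4) (E4.basisVector 0) +
        Minkowski.bilin X ((Λ : E4 ≃L[ℝ] E4) (E4.basisVector 1)) •
          (Λ : E4 ≃L[ℝ] E4) (E4.basisVector 1) +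
        Minkowski.bilin X ((Λ : E4 ≃L[ℝ] E4) (E4.basisVector 2)) •
          (Λ : E4 ≃L[ℝ] E4) (E4.basisVector 2) +
        Minkowski.bilin X ((Λ : E4 ≃L[ℝ] E4) (E4.basisVector 3)) •
          (Λ : E4 ≃L[ℝ] E4) (E4.basisVector 3) := by
  set L : E4 ≃L[ℝ] E4 := (Λ : E4 ≃L[ℝ] E4) with hL
  set Y : E4 := L.symm X with hY
  have hX : X = L Y := (L.apply_symm_apply X).symm
  have hη : ∀ k : Fin 4, Minkowski.bilin X (L (E4.basisVector k)) =
      Minkowski.bilin Y (E4.basisVector k) := fun k ↦ by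
    rw [hX]
    exact Λ.2 Y (E4.basisVector k)
  rw [hη 0, hη 1, hη 2, hη 3, minkowski_basisVector_zero_right, minkowski_basisVector_one_right,
    minkowski_basisVector_two_right, minkowski_basisVector_three_right, neg_neg]
  conv_lhs => rw [hX, Summit.FinalStateConjecture.FinalStateConjecture.Theorems.SublinearIsFree.QuasiStationarity.eq_sum_basisVector Y]
  simp only [map_add, map_smul]

/-! ### Rotated basis vectors -/

/-- `R_θ e₁ = cos θ e₁ + sin θ e₂`. [folklore] -/
theorem rotCLM_basisVector_one (θ : ℝ) :
    rotCLM θ (E4.basisVector 1) = Real.cos θ • E4.basisVector 1 + Real.sin θ • E4.basisVector 2 := by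
  refine E4_ext ?_ ?_ ?_ ?_ <;> simp

/-- `R_θ e₂ = −sin θ e₁ + cos θ e₂`. [folklore] -/
theorem rotCLM_basisVector_two (θ : ℝ) :
    rotCLM θ (E4.basisVector 2) =
      (-Real.sin θ) • E4.basisVector 1 + Real.cos θ • E4.basisVector 2 := by
  refine E4_ext ?_ ?_ ?_ ?_ <;> simp

/-- `R_θ e₃ = e₃`. [folklore] -/
theorem rotCLM_basisVector_three (θ : ℝ) : rotCLM θ (E4.basisVector 3) = E4.basisVector 3 := by
  refine E4_ext ?_ ?_ ?_ ?_ <;> simp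

/-! ### Differentiating constant Minkowski products -/

/-- If `η(f, g)` is constant then `η(f′, g) + η(f, g′) = 0`. [folklore] -/
theorem minkowski_deriv_of_const {f g : ℝ → E4} {f' g' : E4} {t : ℝ} {c : ℝ}
    (hf : HasDerivAt f f' t) (hg : HasDerivAt g g' t) (hc : ∀ s, Minkowski.bilin (f s) (g s) = c) :
    Minkowski.bilin f' (g t) + Minkowski.bilin (f t) g' = 0 := by
  have h1 : HasDerivAt (fun s ↦ Minkowski.bilin (f s)) (Minkowski.bilin f') t :=
    (Minkowski.bilin).hasFDerivAt.comp_hasDerivAt t hf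
  have h2 : HasDerivAt (fun s ↦ Minkowski.bilin (f s) (g s))
      (Minkowski.bilin f' (g t) + Minkowski.bilin (f t) g') t := by
    simpa using h1.clm_apply hg
  have h3 : HasDerivAt (fun s ↦ Minkowski.bilin (f s) (g s)) 0 t := by
    have : (fun s ↦ Minkowski.bilin (f s) (g s)) = fun _ ↦ c := funext hc
    rw [this]
    exact hasDerivAt_const t c
  exact h2.unique h3

/-! ### The untwisted frame -/

/-- **The untwisting angle and the transport laws.** For a smooth Lorentz path `Λ` there is a
smooth angle `θ` (namely `θ = ∫₀ᵗ η(Λe₁, Λ′e₂)`) such that the right translate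
`Λ̃(t) = Λ(t)·R_{θ(t)}` — which paints the same Kerr–Schild field and radius
(`boostedKerrBilin_mul_rotL`, `radius_poincareInv_mul_rotL`) — is smooth, has the same `e₀` and `e₃`
columns `u`, `s`, and its `e₁`, `e₂` columns `p`, `q` obey the TRANSPORT LAWS
`p′ = η(p, u′) u − η(p, s′) s`, `q′ = η(q, u′) u − η(q, s′) s` (the twist cancels). Combined with
`tendsto_iteratedDeriv_of_transport` and `tendsto_iteratedDeriv_clm_zero_of_columns`
(file `…StubRechartLeibniz`) this gives decay of all derivatives of `Λ̃` from those of `u`, `s`.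
[folklore] -/
theorem exists_untwisting_angle' (Λ : ℝ → lorentzGroup)
    (hΛ : ContDiff ℝ ∞ (fun t ↦ ((Λ t : E4 ≃L[ℝ] E4) : E4 →L[ℝ] E4))) :
    ∃ θ : ℝ → ℝ, ContDiff ℝ ∞ θ ∧
      ContDiff ℝ ∞ (fun t ↦ (((Λ t * rotL (θ t) : lorentzGroup) : E4 ≃L[ℝ] E4) : E4 →L[ℝ] E4)) ∧
      (∀ t, ((Λ t * rotL (θ t) : lorentzGroup) : E4 ≃L[ℝ] E4) (E4.basisVector 0) =
        (Λ t : E4 ≃L[ℝ] E4) (E4.basisVector 0)) ∧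
      (∀ t, ((Λ t * rotL (θ t) : lorentzGroup) : E4 ≃L[ℝ] E4) (E4.basisVector 3) =
        (Λ t : E4 ≃L[ℝ] E4) (E4.basisVector 3)) ∧
      (∀ μ : Fin 4, μ = 1 ∨ μ = 2 → ∀ t,
        deriv (fun r ↦ ((Λ r * rotL (θ r) : lorentzGroup) : E4 ≃L[ℝ] E4) (E4.basisVector μ)) t =
          Minkowski.bilin (((Λ t * rotL (θ t) : lorentzGroup) : E4 ≃L[ℝ] E4) (E4.basisVector μ))
              (deriv (fun r ↦ (Λ r : E4 ≃L[ℝ] E4) (E4.basisVector 0)) t) •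
            (Λ t : E4 ≃L[ℝ] E4) (E4.basisVector 0) -
          Minkowski.bilin (((Λ t * rotL (θ t) : lorentzGroup) : E4 ≃L[ℝ] E4) (E4.basisVector μ))
              (deriv (fun r ↦ (Λ r : E4 ≃L[ℝ] E4) (E4.basisVector 3)) t) •
            (Λ t : E4 ≃L[ℝ] E4) (E4.basisVector 3)) := by
  -- the operator path and its columns
  set F : ℝ → E4 →L[ℝ] E4 := fun t ↦ ((Λ t : E4 ≃L[ℝ] E4) : E4 →L[ℝ] E4) with hF
  have hFapp : ∀ t v, F t v = (Λ t : E4 ≃L[ℝ] E4) v := fun _ _ ↦ rfl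
  set u : ℝ → E4 := fun t ↦ F t (E4.basisVector 0) with hudef
  set a : ℝ → E4 := fun t ↦ F t (E4.basisVector 1) with hadef
  set b : ℝ → E4 := fun t ↦ F t (E4.basisVector 2) with hbdef
  set s : ℝ → E4 := fun t ↦ F t (E4.basisVector 3) with hsdef
  have hFd : Differentiable ℝ F := hΛ.differentiable (by simp)
  set F' : ℝ → E4 →L[ℝ] E4 := deriv F with hF'
  have hF's : ContDiff ℝ ∞ F' := (contDiff_infty_iff_deriv.mp hΛ).2
  have hcol : ∀ v : E4, ContDiff ℝ ∞ fun t ↦ F t v := fun v ↦ hΛ.clm_apply contDiff_const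
  have hcol' : ∀ (v : E4) (t : ℝ), HasDerivAt (fun t ↦ F t v) (F' t v) t := fun v t ↦
    ((hFd t).hasDerivAt.clm_apply (hasDerivAt_const t v)).congr_deriv (by simp [hF'])
  have hus : ContDiff ℝ ∞ u := hcol _
  have has : ContDiff ℝ ∞ a := hcol _
  have hbs : ContDiff ℝ ∞ b := hcol _
  have hss : ContDiff ℝ ∞ s := hcol _
  have hu' : ∀ t, HasDerivAt u (F' t (E4.basisVector 0)) t := hcol' _
  have ha' : ∀ t, HasDerivAt a (F' t (E4.basisVector 1)) t := hcol' _
  have hb' : ∀ t, HasDerivAt b (F' t (E4.basisVector 2)) t := hcol' _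
  have hs' : ∀ t, HasDerivAt s (F' t (E4.basisVector 3)) t := hcol' _
  have hdu : ∀ t, deriv u t = F' t (E4.basisVector 0) := fun t ↦ (hu' t).deriv
  have hds : ∀ t, deriv s t = F' t (E4.basisVector 3) := fun t ↦ (hs' t).deriv
  -- orthonormality of the columns (Lorentz invariance)
  have hL : ∀ (t : ℝ) (v w : E4), Minkowski.bilin (F t v) (F t w) = Minkowski.bilin v w :=
    fun t v w ↦ (Λ t).2 v w
  have e00 : ∀ t, Minkowski.bilin (a t) (a t) = 1 := fun t ↦ by
    rw [hadef, hL]; simp [Fin.sum_univ_three]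
  have e11 : ∀ t, Minkowski.bilin (b t) (b t) = 1 := fun t ↦ by
    rw [hbdef, hL]; simp [Fin.sum_univ_three]
  have e01 : ∀ t, Minkowski.bilin (a t) (b t) = 0 := fun t ↦ by
    rw [hadef, hbdef, hL]; simp [Fin.sum_univ_three]
  have ea0 : ∀ t, Minkowski.bilin (a t) (u t) = 0 := fun t ↦ by
    rw [hadef, hudef, hL]; simp
  have eb0 : ∀ t, Minkowski.bilin (b t) (u t) = 0 := fun t ↦ by
    rw [hbdef, hudef, hL]; simp
  have ea3 : ∀ t, Minkowski.bilin (a t) (s t) = 0 := fun t ↦ by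
    rw [hadef, hsdef, hL]; simp [Fin.sum_univ_three, show (2 : Fin 3).succ = (3 : Fin 4) from rfl]
  have eb3 : ∀ t, Minkowski.bilin (b t) (s t) = 0 := fun t ↦ by
    rw [hbdef, hsdef, hL]; simp [Fin.sum_univ_three, show (2 : Fin 3).succ = (3 : Fin 4) from rfl]
  -- the twist rate and the angle
  set tw : ℝ → ℝ := fun t ↦ Minkowski.bilin (a t) (F' t (E4.basisVector 2)) with htwdef
  have htws : ContDiff ℝ ∞ tw :=
    ((Minkowski.bilin).contDiff.comp has).clm_apply (hF's.clm_apply contDiff_const)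
  have htwc : Continuous tw := htws.continuous
  set θ : ℝ → ℝ := fun t ↦ ∫ x in (0 : ℝ)..t, tw x with hθdef
  have hθ' : ∀ t, HasDerivAt θ (tw t) t := fun t ↦
    intervalIntegral.integral_hasDerivAt_right (htwc.intervalIntegrable 0 t)
      (htwc.stronglyMeasurableAtFilter volume (𝓝 t)) htwc.continuousAt
  have hθd : Differentiable ℝ θ := fun t ↦ (hθ' t).differentiableAt
  have hθs : ContDiff ℝ ∞ θ := by
    rw [contDiff_infty_iff_deriv]
    refine ⟨hθd, ?_⟩
    rw [show deriv θ = tw from funext fun t ↦ (hθ' t).deriv]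
    exact htws
  -- differentiated orthonormality relations
  have d_aa : ∀ t, Minkowski.bilin (F' t (E4.basisVector 1)) (a t) = 0 := fun t ↦ by
    have h := minkowski_deriv_of_const (ha' t) (ha' t) e00
    rw [Minkowski.bilin_symm (a t)] at h
    linarith
  have d_bb : ∀ t, Minkowski.bilin (F' t (E4.basisVector 2)) (b t) = 0 := fun t ↦ by
    have h := minkowski_deriv_of_const (hb' t) (hb' t) e11
    rw [Minkowski.bilin_symm (b t)] at h
    linarith
  have d_ab : ∀ t, Minkowski.bilin (F' t (E4.basisVector 1)) (b t) = -tw t := fun t ↦ by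
    have h := minkowski_deriv_of_const (ha' t) (hb' t) e01
    show _ = -Minkowski.bilin (a t) (F' t (E4.basisVector 2))
    linarith
  have d_ba : ∀ t, Minkowski.bilin (F' t (E4.basisVector 2)) (a t) = tw t := fun t ↦ by
    rw [Minkowski.bilin_symm]
  have d_au : ∀ t, Minkowski.bilin (F' t (E4.basisVector 1)) (u t) =
      -Minkowski.bilin (a t) (F' t (E4.basisVector 0)) := fun t ↦ by
    have h := minkowski_deriv_of_const (ha' t) (hu' t) ea0
    linarith
  have d_bu : ∀ t, Minkowski.bilin (F' t (E4.basisVector 2)) (u t) =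
      -Minkowski.bilin (b t) (F' t (E4.basisVector 0)) := fun t ↦ by
    have h := minkowski_deriv_of_const (hb' t) (hu' t) eb0
    linarith
  have d_as : ∀ t, Minkowski.bilin (F' t (E4.basisVector 1)) (s t) =
      -Minkowski.bilin (a t) (F' t (E4.basisVector 3)) := fun t ↦ by
    have h := minkowski_deriv_of_const (ha' t) (hs' t) ea3
    linarith
  have d_bs : ∀ t, Minkowski.bilin (F' t (E4.basisVector 2)) (s t) =
      -Minkowski.bilin (b t) (F' t (E4.basisVector 3)) := fun t ↦ by
    have h := minkowski_deriv_of_const (hb' t) (hs' t) eb3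
    linarith
  -- the derivatives of `a`, `b` in the moving frame
  have hA : ∀ t, F' t (E4.basisVector 1) =
      Minkowski.bilin (a t) (F' t (E4.basisVector 0)) • u t - tw t • b t -
        Minkowski.bilin (a t) (F' t (E4.basisVector 3)) • s t := fun t ↦ by
    have h := frame_expansion (Λ t) (F' t (E4.basisVector 1))
    rw [← hFapp, ← hFapp, ← hFapp, ← hFapp] at h
    change F' t (E4.basisVector 1) = (-Minkowski.bilin (F' t (E4.basisVector 1)) (u t)) • u t +
      Minkowski.bilin (F' t (E4.basisVector 1)) (a t) • a t +
      Minkowski.bilin (F' t (E4.basisVector 1)) (b t) • b t +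
      Minkowski.bilin (F' t (E4.basisVector 1)) (s t) • s t at h
    rw [d_au, d_aa, d_ab, d_as] at h
    rw [h]
    module
  have hB : ∀ t, F' t (E4.basisVector 2) =
      Minkowski.bilin (b t) (F' t (E4.basisVector 0)) • u t + tw t • a t -
        Minkowski.bilin (b t) (F' t (E4.basisVector 3)) • s t := fun t ↦ by
    have h := frame_expansion (Λ t) (F' t (E4.basisVector 2))
    rw [← hFapp, ← hFapp, ← hFapp, ← hFapp] at h
    change F' t (E4.basisVector 2) = (-Minkowski.bilin (F' t (E4.basisVector 2)) (u t)) • u t +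
      Minkowski.bilin (F' t (E4.basisVector 2)) (a t) • a t +
      Minkowski.bilin (F' t (E4.basisVector 2)) (b t) • b t +
      Minkowski.bilin (F' t (E4.basisVector 2)) (s t) • s t at h
    rw [d_bu, d_ba, d_bb, d_bs] at h
    rw [h]
    module
  -- the untwisted columns `p`, `q` and their transport laws
  set p : ℝ → E4 := fun t ↦ Real.cos (θ t) • a t + Real.sin (θ t) • b t with hpdef
  set q : ℝ → E4 := fun t ↦ (-Real.sin (θ t)) • a t + Real.cos (θ t) • b t with hqdef
  have hcs : ContDiff ℝ ∞ fun t ↦ Real.cos (θ t) := Real.contDiff_cos.comp hθs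
  have hsn : ContDiff ℝ ∞ fun t ↦ Real.sin (θ t) := Real.contDiff_sin.comp hθs
  have hps : ContDiff ℝ ∞ p := (hcs.smul has).add (hsn.smul hbs)
  have hqs : ContDiff ℝ ∞ q := (hsn.neg.smul has).add (hcs.smul hbs)
  have hcos' : ∀ t, HasDerivAt (fun t ↦ Real.cos (θ t)) (-Real.sin (θ t) * tw t) t := fun t ↦
    (Real.hasDerivAt_cos (θ t)).comp t (hθ' t)
  have hsin' : ∀ t, HasDerivAt (fun t ↦ Real.sin (θ t)) (Real.cos (θ t) * tw t) t := fun t ↦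
    (Real.hasDerivAt_sin (θ t)).comp t (hθ' t)
  have hp' : ∀ t, HasDerivAt p ((Real.cos (θ t) • F' t (E4.basisVector 1) +
      (-Real.sin (θ t) * tw t) • a t) + (Real.sin (θ t) • F' t (E4.basisVector 2) +
      (Real.cos (θ t) * tw t) • b t)) t := fun t ↦
    ((hcos' t).smul (ha' t)).add ((hsin' t).smul (hb' t))
  have hq' : ∀ t, HasDerivAt q (((-Real.sin (θ t)) • F' t (E4.basisVector 1) +
      (-(Real.cos (θ t) * tw t)) • a t) + (Real.cos (θ t) • F' t (E4.basisVector 2) +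
      (-Real.sin (θ t) * tw t) • b t)) t := fun t ↦
    ((hsin' t).neg.smul (ha' t)).add ((hcos' t).smul (hb' t))
  have hpode : ∀ t, deriv p t = (Minkowski.bilin (p t) (deriv u t)) • u t -
      (Minkowski.bilin (p t) (deriv s t)) • s t := fun t ↦ by
    rw [(hp' t).deriv, hdu, hds, hA, hB]
    simp only [hpdef, map_add, map_smul, add_apply, smul_apply, smul_eq_mul]
    module
  have hqode : ∀ t, deriv q t = (Minkowski.bilin (q t) (deriv u t)) • u t -
      (Minkowski.bilin (q t) (deriv s t)) • s t := fun t ↦ by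
    rw [(hq' t).deriv, hdu, hds, hA, hB]
    simp only [hqdef, map_add, map_smul, map_neg, add_apply, smul_apply, neg_apply, smul_eq_mul,
      neg_smul, neg_mul]
    module
  -- the untwisted operator path
  set Ft : ℝ → E4 →L[ℝ] E4 := fun t ↦ (F t).comp (rotCLM (θ t)) with hFt
  have hFts : ContDiff ℝ ∞ Ft := hΛ.clm_comp (contDiff_rotCLM.comp hθs)
  have hFt_eq : (fun t ↦ (((Λ t * rotL (θ t) : lorentzGroup) : E4 ≃L[ℝ] E4) : E4 →L[ℝ] E4)) =
      Ft := funext fun t ↦ coe_mul_rotL (Λ t) (θ t)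
  have c0 : (fun t ↦ Ft t (E4.basisVector 0)) = u := funext fun t ↦ by
    simp only [hFt, ContinuousLinearMap.comp_apply, rotCLM_basisVector_zero]
    rfl
  have c3 : (fun t ↦ Ft t (E4.basisVector 3)) = s := funext fun t ↦ by
    simp only [hFt, ContinuousLinearMap.comp_apply, rotCLM_basisVector_three]
    rfl
  have c1 : (fun t ↦ Ft t (E4.basisVector 1)) = p := funext fun t ↦ by
    simp only [hFt, hpdef, ContinuousLinearMap.comp_apply, rotCLM_basisVector_one, map_add,
      map_smul]
    rfl
  have c2 : (fun t ↦ Ft t (E4.basisVector 2)) = q := funext fun t ↦ by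
    simp only [hFt, hqdef, ContinuousLinearMap.comp_apply, rotCLM_basisVector_two, map_add,
      map_smul]
    rfl

  -- packaging in terms of `Λ t * rotL (θ t)`
  have happ : ∀ (t : ℝ) (v : E4), ((Λ t * rotL (θ t) : lorentzGroup) : E4 ≃L[ℝ] E4) v = Ft t v := by
    intro t v
    have h : (((Λ t * rotL (θ t) : lorentzGroup) : E4 ≃L[ℝ] E4) : E4 →L[ℝ] E4) = Ft t :=
      congrFun hFt_eq t
    rw [← h]
    rfl
  have hc0 : ∀ t, ((Λ t * rotL (θ t) : lorentzGroup) : E4 ≃L[ℝ] E4) (E4.basisVector 0) = u t :=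
    fun t ↦ by rw [happ]; exact congrFun c0 t
  have hc3 : ∀ t, ((Λ t * rotL (θ t) : lorentzGroup) : E4 ≃L[ℝ] E4) (E4.basisVector 3) = s t :=
    fun t ↦ by rw [happ]; exact congrFun c3 t
  have hc1 : (fun r ↦ ((Λ r * rotL (θ r) : lorentzGroup) : E4 ≃L[ℝ] E4) (E4.basisVector 1)) = p := by
    funext r; rw [happ]; exact congrFun c1 r
  have hc2 : (fun r ↦ ((Λ r * rotL (θ r) : lorentzGroup) : E4 ≃L[ℝ] E4) (E4.basisVector 2)) = q := by
    funext r; rw [happ]; exact congrFun c2 r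
  refine ⟨θ, hθs, by rw [hFt_eq]; exact hFts, hc0, hc3, ?_⟩
  rintro μ (rfl | rfl) t
  · rw [hc1, show ((Λ t * rotL (θ t) : lorentzGroup) : E4 ≃L[ℝ] E4) (E4.basisVector 1) = p t from
      congrFun hc1 t]
    exact hpode t
  · rw [hc2, show ((Λ t * rotL (θ t) : lorentzGroup) : E4 ≃L[ℝ] E4) (E4.basisVector 2) = q t from
      congrFun hc2 t]
    exact hqode t

/-- Registered sub-goal form (stub `exists_untwisting_angle` of the crux item) of
`exists_untwisting_angle'`: the untwisting angle and the transport laws. [folklore] -/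
theorem exists_untwisting_angle : open Literature.Geometry.Lorentzian Summit.FinalStateConjecture.FinalStateConjecture.Theorems.InertialRecession.Negative in ∀ (Λ : ℝ → lorentzGroup), ContDiff ℝ ((⊤ : ℕ∞) : WithTop ℕ∞) (fun t ↦ ((Λ t : E4 ≃L[ℝ] E4) : E4 →L[ℝ] E4)) → ∃ θ : ℝ → ℝ, ContDiff ℝ ((⊤ : ℕ∞) : WithTop ℕ∞) θ ∧ ContDiff ℝ ((⊤ : ℕ∞) : WithTop ℕ∞) (fun t ↦ (((Λ t * rotL (θ t) : lorentzGroup) : E4 ≃L[ℝ] E4) : E4 →L[ℝ] E4)) ∧ (∀ t, ((Λ t * rotL (θ t) : lorentzGroup) : E4 ≃L[ℝ] E4) (E4.basisVector 0) = (Λ t : E4 ≃L[ℝ] E4) (E4.basisVector 0)) ∧ (∀ t, ((Λ t * rotL (θ t) : lorentzGroup) : E4 ≃L[ℝ] E4) (E4.basisVector 3) = (Λ t : E4 ≃L[ℝ] E4) (E4.basisVector 3)) ∧ (∀ μ : Fin 4, μ = 1 ∨ μ = 2 → ∀ t, deriv (fun r ↦ ((Λ r * rotL (θ r) : lorentzGroup)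 : E4 ≃L[ℝ] E4) (E4.basisVector μ)) t = Minkowski.bilin (((Λ t * rotL (θ t) : lorentzGroup) : E4 ≃L[ℝ] E4) (E4.basisVector μ)) (deriv (fun r ↦ (Λ r : E4 ≃L[ℝ] E4) (E4.basisVector 0)) t) • (Λ t : E4 ≃L[ℝ] E4) (E4.basisVector 0) - Minkowski.bilin (((Λ t * rotL (θ t) : lorentzGroup) : E4 ≃L[ℝ] E4) (E4.basisVector μ)) (deriv (fun r ↦ (Λ r : E4 ≃L[ℝ] E4) (E4.basisVector 3)) t) • (Λ t : E4 ≃L[ℝ] E4) (E4.basisVector 3)) :=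
  fun Λ hΛ ↦ exists_untwisting_angle' Λ hΛ

end Summit.FinalStateConjecture.FinalStateConjecture.Theorems.SublinearIsFree.Rechart

end
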